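import Summits.Ventures.HSemireg.WedgeHankelRankProfileTrapezoid
import Summits.Ventures.HSemireg.WedgeHankelClassMapRank

/-!
# Venture HSemireg — THE MIDDLE RANK IS THE RECURRENCE ORDER (a finite Kronecker theorem): for `2r ≤ N`, **`R(q) = rank H_{⌊N/2⌋}(q) ≤ r` iff the coefficient sequence
# `q_0, …, q_N` satisfies a non-trivial linear recurrence `Σ_{i ≤ r} a_i q_{i+s} = 0` (`s ≤ N − r`)** — equivalently (binomials `C(r,i)` non-zero in `K`) iff the class `w_N(q)` is
# KILLED by a non-zero sub-box class `w_r(c)`: the annihilator threshold of a class IS its middle Hankel rank; `R(q) = 0` iff `q` vanishes on `[0, N]`, `R(q) = ⌊N/2⌋ + 1` iff no recurrence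
# of order `≤ ⌊N/2⌋` exists

HONEST FRAMING. Part of the Lean index of the computation cell `pub-hsemireg` (seat p10 gen 25, Sunday typer «UNIFORM-IN-n»).
LINEAR ALGEBRA OF HANKEL (catalecticant) MATRICES + finite-dimensional EXTERIOR ALGEBRA over a field ONLY: no variety, no cohomology theory, no sheaf, no Ext group and no semiregularity map
is constructed here; nothing here says that HC / HC_CM / HC_AV holds; no Literature fact is declared or used.  Custodian versions as in `WedgeHankelSiegelIdeal` (1/3); the dictionary
(`rank H_k(q)` = the Hankel factor of THEOREM H; `w_r(c) ∧ w_N(q)` = the product of a sub-box class with the class) is QUOTED, never asserted.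

WHAT IS IN THE TREE / KEYED.  N15 (`WedgeHankelRankProfileTrapezoid`, keyed) `rank_hankel1_eq_min_left` (`k ≤ j`, `2j ≤ N`: `rank H_k = min(k+1, rank H_j)`); p10 g24's M9
(`WedgeHankelClassMapRank`) `vecMul_hankel1_injective_iff` (`v ↦ v ᵥ* H_k(q)` injective iff `rank H_k(q) = k + 1`), `exists_w_mul_w_eq_zero_of_rank_le`, `forall_coeff_eq_zero_of_w_mul_w_eq_zero`
(all `C(k,r) ≠ 0` in `K`); Mathlib `Matrix.rank_le_height`, `Matrix.coe_vecMulLinear`.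
THIS FILE (namespace `Summit.Ventures.HSemireg.Wedge.HankelOuter` continued; CHAINED on N15; imports M9):
* §462 `rank_hankel1_le_iff_half_le` (`2r ≤ N`: `rank H_r(q) ≤ r ↔ R(q) ≤ r`), `rank_hankel1_eq_succ_iff_lt_half` (`rank H_r(q) = r + 1 ↔ r < R(q)`), `exists_vecMul_hankel1_eq_zero_iff`
  (every `k`: a non-zero left-kernel vector of `H_k(q)` exists iff `rank H_k(q) ≤ k`), `vecMul_hankel1_eq_zero_iff` (`a ᵥ* H_k(q) = 0` spelled out as the recurrence
  `Σ_i a_i q_{i+s} = 0`, `s + k ≤ N`), **`rank_hankel1_half_le_iff_exists_recurrence`** (`2r ≤ N`: `R(q) ≤ r ↔ ∃ a ≠ 0, ∀ s ≤ N − r, Σ_{i ≤ r} a_i q_{i+s} = 0`),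
  `rank_hankel1_half_eq_zero_iff` (`R(q) = 0 ↔ q = 0` on `[0, N]`), `rank_hankel1_half_eq_succ_iff` (`R(q) = ⌊N/2⌋ + 1 ↔` only the zero vector gives a recurrence of order `⌊N/2⌋`).
* §463 THE ANNIHILATOR THRESHOLD (all `C(r,i) ≠ 0` in `K`, e.g. `char K = 0` or `> r`): **`rank_hankel1_half_le_iff_exists_w_mul_w_eq_zero`** (`2r ≤ N`: `R(q) ≤ r ↔` some sub-box class
  `w_r(c)` with a non-zero coefficient `c_j`, `j ≤ r`, has `w_r(c) ∧ w_N(q) = 0`), `lt_rank_hankel1_half_iff_forall_w_mul_w` (`r < R(q) ↔` only `c = 0` on `[0, r]` kills).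
READING: FORMULA-N's `R(q)` (the one integer per class of N15/N16) is the ORDER OF THE SHORTEST LINEAR RECURRENCE of `q_0 … q_N` (capped at `⌊N/2⌋ + 1`), and on the class side the least
degree in which `w_N(q)` has a non-zero annihilator among the sub-box classes.  Nothing Ext-side.  New names only.
-/

open Module
open scoped Matrix

namespace Summit.Ventures.HSemireg.Wedge.HankelOuter

open Summit.Ventures.HSemireg.Wedge Summit.Ventures.HSemireg.Wedge.Kunneth Summit.Ventures.HSemireg.Wedge.Hankel
  Summit.Ventures.HSemireg.Wedge.BasisFree Summit.Ventures.HSemireg.Wedge.HankelSiegel Summit.Ventures.HSemireg.Wedge.HankelSiegelIdeal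
  Summit.Ventures.HSemireg.Wedge.KunnethKernel Summit.Ventures.HSemireg.Wedge.HankelFrameChange Summit.Ventures.HSemireg.Wedge.KernelDuality

variable (K : Type*) [Field K] {N : ℕ}

/-! ## §462. The middle rank is the recurrence order -/

/-- **`rank H_r(q) ≤ r ↔ R(q) ≤ r`** for `2r ≤ N` (`rank H_r = min(r + 1, R)`). -/
theorem rank_hankel1_le_iff_half_le {r : ℕ} (hr : 2 * r ≤ N) (q : ℕ → K) :
    (hankel1 K N r q).rank ≤ r ↔ (hankel1 K N (N / 2) q).rank ≤ r := by
  rw [rank_hankel1_eq_min_left K (show r ≤ N / 2 by omega) (Nat.mul_div_le N 2) q]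
  constructor
  · intro h
    by_contra hlt
    rw [min_eq_left (by omega : r + 1 ≤ (hankel1 K N (N / 2) q).rank)] at h
    omega
  · intro h
    exact (min_le_right _ _).trans h

/-- **`rank H_r(q) = r + 1 ↔ r < R(q)`** for `2r ≤ N`. -/
theorem rank_hankel1_eq_succ_iff_lt_half {r : ℕ} (hr : 2 * r ≤ N) (q : ℕ → K) :
    (hankel1 K N r q).rank = r + 1 ↔ r < (hankel1 K N (N / 2) q).rank := by
  have h1 := rank_hankel1_le_iff_half_le K hr q
  have h2 : (hankel1 K N r q).rank ≤ r + 1 := Matrix.rank_le_height _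
  omega

/-- **a non-zero left-kernel vector of `H_k(q)` exists iff `rank H_k(q) ≤ k`** (every `k`; the rows number `k + 1`). -/
theorem exists_vecMul_hankel1_eq_zero_iff (k : ℕ) (q : ℕ → K) :
    (∃ a : Fin (k + 1) → K, a ≠ 0 ∧ a ᵥ* hankel1 K N k q = 0) ↔ (hankel1 K N k q).rank ≤ k := by
  have hrows : (hankel1 K N k q).rank ≤ k + 1 := Matrix.rank_le_height _
  have hinj := vecMul_hankel1_injective_iff K (N := N) k q
  constructor
  · rintro ⟨a, ha, h0⟩
    by_contra hlt
    have hfull : (hankel1 K N k q).rank = k + 1 := by omega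
    exact ha (hinj.mpr hfull (show a ᵥ* hankel1 K N k q = 0 ᵥ* hankel1 K N k q by rw [h0, Matrix.zero_vecMul]))
  · intro hle
    have hni : ¬ Function.Injective (hankel1 K N k q).vecMulLinear := by
      rw [Matrix.coe_vecMulLinear, hinj]
      omega
    rw [injective_iff_map_eq_zero] at hni
    push Not at hni
    obtain ⟨a, ha0, hane⟩ := hni
    exact ⟨a, hane, by rwa [Matrix.coe_vecMulLinear] at ha0⟩

/-- **`a ᵥ* H_k(q) = 0` IS the linear recurrence `Σ_{i ≤ k} a_i q_{i+s} = 0` for all `s` with `s + k ≤ N`.** -/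
theorem vecMul_hankel1_eq_zero_iff (k : ℕ) (q : ℕ → K) (a : Fin (k + 1) → K) :
    a ᵥ* hankel1 K N k q = 0 ↔ ∀ s : ℕ, s + k ≤ N → ∑ i : Fin (k + 1), a i * q ((i : ℕ) + s) = 0 := by
  constructor
  · intro h s hs
    have := congrFun h ⟨s, by omega⟩
    simpa [Matrix.vecMul, dotProduct, hankel1] using this
  · intro h
    funext t
    have := h (t : ℕ) (by have := t.2; omega)
    simpa [Matrix.vecMul, dotProduct, hankel1] using this

/-- **THE MIDDLE RANK IS THE RECURRENCE ORDER: for `2r ≤ N`, `R(q) ≤ r` iff `q_0, …, q_N` satisfies a non-trivial linear recurrence with window `r + 1`,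
`Σ_{i ≤ r} a_i q_{i+s} = 0` for all `s ≤ N − r`** (a finite Kronecker theorem; every field). -/
theorem rank_hankel1_half_le_iff_exists_recurrence {r : ℕ} (hr : 2 * r ≤ N) (q : ℕ → K) :
    (hankel1 K N (N / 2) q).rank ≤ r ↔ ∃ a : Fin (r + 1) → K, a ≠ 0 ∧ ∀ s : ℕ, s + r ≤ N → ∑ i : Fin (r + 1), a i * q ((i : ℕ) + s) = 0 := by
  rw [← rank_hankel1_le_iff_half_le K hr, ← exists_vecMul_hankel1_eq_zero_iff]
  simp only [vecMul_hankel1_eq_zero_iff]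

/-- **`R(q) = 0 ↔ q` vanishes on `[0, N]`.** -/
theorem rank_hankel1_half_eq_zero_iff (q : ℕ → K) : (hankel1 K N (N / 2) q).rank = 0 ↔ ∀ j ≤ N, q j = 0 := by
  rw [← Nat.le_zero, rank_hankel1_half_le_iff_exists_recurrence K (by omega) q]
  constructor
  · rintro ⟨a, ha, h⟩ j hj
    have h0 : a 0 ≠ 0 := by
      intro h0; apply ha; funext i; rw [Fin.fin_one_eq_zero i, h0, Pi.zero_apply]
    have := h j (by omega)
    rw [Fin.sum_univ_one, Fin.val_zero, zero_add, mul_eq_zero] at this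
    exact this.resolve_left h0
  · intro h
    refine ⟨fun _ => 1, fun h0 => one_ne_zero (congrFun h0 0), fun s hs => ?_⟩
    rw [Fin.sum_univ_one, one_mul, Fin.val_zero, zero_add]
    exact h s (by omega)

/-- **`R(q) = ⌊N/2⌋ + 1` (Hankel-generic) iff only the zero vector gives a recurrence of order `⌊N/2⌋`.** -/
theorem rank_hankel1_half_eq_succ_iff (q : ℕ → K) :
    (hankel1 K N (N / 2) q).rank = N / 2 + 1
      ↔ ∀ a : Fin (N / 2 + 1) → K, (∀ s : ℕ, s + N / 2 ≤ N → ∑ i : Fin (N / 2 + 1), a i * q ((i : ℕ) + s) = 0) → a = 0 := by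
  have hle : (hankel1 K N (N / 2) q).rank ≤ N / 2 + 1 := Matrix.rank_le_height _
  have h1 := rank_hankel1_half_le_iff_exists_recurrence K (Nat.mul_div_le N 2) q
  constructor
  · intro h a ha
    by_contra hne
    have : (hankel1 K N (N / 2) q).rank ≤ N / 2 := h1.mpr ⟨a, hne, ha⟩
    omega
  · intro h
    by_contra hne
    obtain ⟨a, ha, h0⟩ := h1.mp (by omega)
    exact ha (h a h0)

/-! ## §463. The annihilator threshold of a class -/

/-- **THE ANNIHILATOR THRESHOLD: for `2r ≤ N` and all `C(r,i)` non-zero in `K`, `R(q) ≤ r` iff some sub-box class `w_r(c)` with a non-zero coefficient `c_j` (`j ≤ r`) has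
`w_r(c) ∧ w_N(q) = 0`** — the least degree in which the class `w_N(q)` is killed by a non-zero sub-box class is its middle Hankel rank. -/
theorem rank_hankel1_half_le_iff_exists_w_mul_w_eq_zero {r : ℕ} (hr : 2 * r ≤ N) (hK : ∀ i ≤ r, (r.choose i : K) ≠ 0) (q : ℕ → K) :
    (hankel1 K N (N / 2) q).rank ≤ r ↔ ∃ c : ℕ → K, (∃ j ≤ r, c j ≠ 0) ∧ w K N r c * w K N N q = 0 := by
  rw [← rank_hankel1_le_iff_half_le K hr]
  constructor
  · exact exists_w_mul_w_eq_zero_of_rank_le K (by omega) hK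
  · rintro ⟨c, ⟨j, hj, hcj⟩, h0⟩
    by_contra hlt
    have hrows : (hankel1 K N r q).rank ≤ r + 1 := Matrix.rank_le_height _
    exact hcj (forall_coeff_eq_zero_of_w_mul_w_eq_zero K (by omega) hK (by omega) h0 j hj)

/-- **… and `r < R(q)` iff only the classes `w_r(c)` with `c = 0` on `[0, r]` kill `w_N(q)`** (`2r ≤ N`, all `C(r,i) ≠ 0` in `K`). -/
theorem lt_rank_hankel1_half_iff_forall_w_mul_w {r : ℕ} (hr : 2 * r ≤ N) (hK : ∀ i ≤ r, (r.choose i : K) ≠ 0) (q : ℕ → K) :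
    r < (hankel1 K N (N / 2) q).rank ↔ ∀ c : ℕ → K, w K N r c * w K N N q = 0 → ∀ j ≤ r, c j = 0 := by
  rw [← rank_hankel1_eq_succ_iff_lt_half K hr, rank_hankel1_eq_succ_iff_forall_w_mul_w K (by omega) hK]

end Summit.Ventures.HSemireg.Wedge.HankelOuter
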